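import Mathlib

/-!
# Sketch — ideator 1 (gen 2), crux `ApproximationProperty` (stmt-Schanuel-6117), round 1

First lemma of the card `first-obstruction-recycling`: the pigeonhole core of the
OBSTRUCTION-SCALE INEQUALITY.  In the application `N = C(δ+n, n)` indexes the monomials of degree `δ`,
`w = (x^μ/‖x‖^δ)_μ` is the normalised Veronese vector of the point `x ∈ ℙⁿ(ℂ)`, `2M ≈ e^τ`,
`2ε ≈ e^{-S}`, and `L = ℤ^N ∩ ℚ-span{height-≤-τ forms vanishing on the obstruction W}` (corank
`m = H_W(δ) + b′`).  Contrapositive: if every `(τ, S)`-small form lies in `L` (i.e. `W` obstructs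
Philippon's hypothesis (H)(3) at scale `S`), then `S ≥ (m/2 − 1)τ − ½ log(16 N)`.
-/

namespace Summit.Schanuel.Schanuel.Cruxes.ApproximationProperty.Ideator1

open Finset

/-- **Obstruction-scale inequality, pigeonhole form.**  Let `L ≤ ℤ^N` be contained in a `ℚ`-subspace
`V` with `finrank V + m ≤ N`, and let `w : Fin N → ℂ` have coordinates of norm `≤ 1`.  If
`ε² (2M+1)^m ≥ 8 M² N² + 16 ε²` then some integer vector of sup-norm `≤ 2M` lies OUTSIDE `L` and has
`‖Σ vᵢ wᵢ‖ ≤ 2ε`.  Proof sketch: the `(2M+1)^N` vectors of the cube map into a disc of radius `MN`, covered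
by `≤ 4M²N²/ε² + 2` squares of diameter `2ε`; a coset of `L` meets the cube in `≤ (2M+1)^{N−m}` points
(a coordinate projection injective on `V`); pigeonhole gives two vectors in one square and different cosets. -/
theorem exists_small_value_not_mem
    (N m M : ℕ) (w : Fin N → ℂ) (hw : ∀ i, ‖w i‖ ≤ 1)
    (L : AddSubgroup (Fin N → ℤ)) (V : Submodule ℚ (Fin N → ℚ))
    (hV : Module.finrank ℚ V + m ≤ N)
    (hLV : ∀ v ∈ L, (fun i => (v i : ℚ)) ∈ V)
    (ε : ℝ) (hε : 0 < ε)
    (h : 8 * (M : ℝ) ^ 2 * (N : ℝ) ^ 2 + 16 * ε ^ 2 ≤ ε ^ 2 * (2 * M + 1 : ℝ) ^ m) :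
    ∃ v : Fin N → ℤ, v ∉ L ∧ (∀ i, |v i| ≤ 2 * (M : ℤ)) ∧ ‖∑ i, (v i : ℂ) * w i‖ ≤ 2 * ε := by
  sorry

/-- The same statement read as a LOWER BOUND ON THE OBSTRUCTION SCALE: if every integer vector of
sup-norm `≤ 2M` with `‖Σ vᵢwᵢ‖ ≤ 2ε` lies in `L`, then `ε²(2M+1)^m < 8M²N² + 16ε²`, i.e. with
`2M+1 = e^τ`, `2ε = e^{-S}`: `S > (m/2 − 1)τ − ½·log(16N) − O(1)`. -/
theorem obstruction_scale_lower_bound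
    (N m M : ℕ) (w : Fin N → ℂ) (hw : ∀ i, ‖w i‖ ≤ 1)
    (L : AddSubgroup (Fin N → ℤ)) (V : Submodule ℚ (Fin N → ℚ))
    (hV : Module.finrank ℚ V + m ≤ N)
    (hLV : ∀ v ∈ L, (fun i => (v i : ℚ)) ∈ V)
    (ε : ℝ) (hε : 0 < ε)
    (hall : ∀ v : Fin N → ℤ, (∀ i, |v i| ≤ 2 * (M : ℤ)) → ‖∑ i, (v i : ℂ) * w i‖ ≤ 2 * ε → v ∈ L) :
    ε ^ 2 * (2 * M + 1 : ℝ) ^ m < 8 * (M : ℝ) ^ 2 * (N : ℝ) ^ 2 + 16 * ε ^ 2 := by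
  by_contra hlt
  push_neg at hlt
  obtain ⟨v, hvL, hvM, hvw⟩ := exists_small_value_not_mem N m M w hw L V hV hLV ε hε hlt
  exact hvL (hall v hvM hvw)

end Summit.Schanuel.Schanuel.Cruxes.ApproximationProperty.Ideator1
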